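import Summits.Parity.GeneralizedHardyLittlewood.Theorems.BeyondDiagonalBeatsQuarter.OffDiagDualCostSlice
import Summits.Parity.GeneralizedHardyLittlewood.Theorems.BeyondDiagonalBeatsQuarter.OffDiagPoissonApplied
import HarnessLib

/-!
# Route `PrimeLevelFamEdge`, crux K_B (stmt-Parity-20343), line `diagonal_kernel_split` rev 4, plan Ω,
# lemma L2c (derivative costs), step 6: **the `y₁`-derivatives of d5's box weight `OffDiag.boxWeight`**

The slices of `Φ_i = OffDiag.boxWeight q d₁ d₂ α β r i` ARE slices of step 5: on the open quadrant the layer weight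
`OffDiag.layerWeightR` depends on `(y₁,y₂)` only through `t = y₁y₂`, so at fixed `y₂ ≥ 0`
`layerWeightR … (y₁,y₂) = C·y₁^{−1/2}·W(a y₁)·J₁(b√y₁)` with `C = (d₁d₂y₂)^{−1/2}r⁻¹`, `a = d₁d₂y₂/q̂²`,
`b = 4π√(αβy₂)/(qr)` (`layerWeightR_eq_profile`), and the `y₁`-slice of `Φ_i` is the (real, then `ofReal`)
slice of step 5 (`boxWeight_slice_eq`). Consequently (**`norm_iteratedDeriv_boxWeight_slice_le`**), for
`q, d₁, d₂ ≥ 1`, `y₂ > 0`, `0 < y₁ ≤ 2·2^{i₁}` and every `k`: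
`‖∂₁ᵏ Φ_i(y₁,y₂)‖ ≤ 𝓒_k · (1 + b√y₁)ᵏ · θ(y₂/2^{i₂}) · (d₁d₂y₂)^{−1/2} r⁻¹ y₁^{−1/2} · y₁^{−k}`
(`𝓒_k` of step 5; `b√y₁ = 4π√(αβy₁y₂)/(qr) = Z`): the per-derivative cost `(1+Z)/y₁ ≤ 2(1+Z)/K₁` of
OMEGA-BLUEPRINT §2. Left for L2c: the box integrals `A_k`, `B_k` and the plug-in (`OffDiagDualTruncationBound`).

Folklore real analysis, PROVED; theorems only. Helper; closes nothing.
«The programme SEARCHES and TYPES; no claim about Landau–Siegel zeros, Theorems 1–2 of arXiv:2211.02515 or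
a repaired Margin232 until a kernel theorem says so.»
-/

noncomputable section

open Real Set Finset
open scoped Topology ContDiff Nat

namespace Summit.Parity.GeneralizedHardyLittlewood.Theorems.BeyondDiagonalBeatsQuarter.OffDiagPoissonTwisted

open Literature.Analysis.FunctionSpaces Literature.NumberTheory.LFunctions.KMV2000
open Literature.Analysis.Calculus.WhitneyConvex (dyadicBump dyadicBumpBound dyadicBump_of_le_half
  dyadicBump_nonneg)
open OffDiag (boxWeight layerWeightR)

section BoxWeight

variable {q d₁ d₂ α β r : ℕ}

/-- **The layer weight is a profile in `y₁`**: for `y₁, y₂ ≥ 0`,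
`layerWeightR q d₁ d₂ α β r (y₁,y₂) = C·y₁^{−1/2}·(W(a y₁)·J₁(b√y₁))`, `C = (d₁d₂y₂)^{−1/2}r⁻¹`,
`a = d₁d₂y₂/q̂²`, `b = 4π√(αβy₂)/(qr)`. [folklore] -/
theorem layerWeightR_eq_profile {y₂ : ℝ} (hy₂ : 0 ≤ y₂) {y₁ : ℝ} (hy₁ : 0 ≤ y₁) :
    layerWeightR q d₁ d₂ α β r (y₁, y₂) =
      (((d₁ : ℝ) * d₂ * y₂) ^ (-(1 : ℝ) / 2) * (r : ℝ)⁻¹) * y₁ ^ (-(1 : ℝ) / 2) *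
        (cutoffW (((d₁ : ℝ) * d₂ * y₂ / qhat q ^ 2) * y₁) *
          besselJ 1 ((4 * π * Real.sqrt ((α : ℝ) * β * y₂) / ((q : ℝ) * r)) * Real.sqrt y₁)) := by
  rw [layerWeightR]
  dsimp only
  have hd : 0 ≤ (d₁ : ℝ) * d₂ * y₂ := by positivity
  have hab : 0 ≤ (α : ℝ) * β * y₂ := by positivity
  have h1 : (d₁ : ℝ) * y₁ * ((d₂ : ℝ) * y₂) = ((d₁ : ℝ) * d₂ * y₂) * y₁ := by ring
  have h2 : (α : ℝ) * y₁ * ((β : ℝ) * y₂) = ((α : ℝ) * β * y₂) * y₁ := by ring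
  have h3 : ((d₁ : ℝ) * d₂ * y₂) * y₁ / qhat q ^ 2 = ((d₁ : ℝ) * d₂ * y₂ / qhat q ^ 2) * y₁ := by ring
  have h4 : 4 * π * (Real.sqrt ((α : ℝ) * β * y₂) * Real.sqrt y₁) / ((q : ℝ) * r) =
      (4 * π * Real.sqrt ((α : ℝ) * β * y₂) / ((q : ℝ) * r)) * Real.sqrt y₁ := by ring
  rw [h1, h2, Real.mul_rpow hd hy₁, Real.sqrt_mul hab, h3, h4,
    show (-(1 / 2 : ℝ)) = -(1 : ℝ) / 2 by norm_num]
  ring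

/-- **The `y₁`-slice of the box weight is the slice of step 5** (for `y₂ ≥ 0`; for `y₁ < 0` both sides vanish with
the bump). [folklore] -/
theorem boxWeight_slice_eq (i : ℕ × ℕ) {y₂ : ℝ} (hy₂ : 0 ≤ y₂) :
    (fun y₁ : ℝ => boxWeight q d₁ d₂ α β r i y₁ y₂) = fun y₁ : ℝ =>
      (((dyadicBump (y₁ / 2 ^ i.1) * (dyadicBump (y₂ / 2 ^ i.2) *
        ((((d₁ : ℝ) * d₂ * y₂) ^ (-(1 : ℝ) / 2) * (r : ℝ)⁻¹) * y₁ ^ (-(1 : ℝ) / 2) *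
          (cutoffW (((d₁ : ℝ) * d₂ * y₂ / qhat q ^ 2) * y₁) *
            besselJ 1 ((4 * π * Real.sqrt ((α : ℝ) * β * y₂) / ((q : ℝ) * r)) * Real.sqrt y₁)))) : ℝ)) :
        ℂ) := by
  funext y₁
  rw [boxWeight]
  by_cases hy₁ : 0 ≤ y₁
  · rw [layerWeightR_eq_profile hy₂ hy₁]
    push_cast
    ring
  · have hθ : dyadicBump (y₁ / 2 ^ i.1) = 0 := by
      refine dyadicBump_of_le_half ?_
      have : y₁ / 2 ^ i.1 ≤ 0 := div_nonpos_of_nonpos_of_nonneg (le_of_lt (not_le.mp hy₁)) (by positivity)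
      linarith
    simp [hθ]

/-- The real slice is smooth at every `y₁ > 0` (`y₂ > 0`, `d₁, d₂ ≥ 1`, `q ≥ 1`). [folklore] -/
theorem contDiffAt_boxSlice [NeZero q] (hd₁ : 1 ≤ d₁) (hd₂ : 1 ≤ d₂) (i : ℕ × ℕ) {y₂ : ℝ} (hy₂ : 0 < y₂)
    {y₁ : ℝ} (hy₁ : 0 < y₁) (n : ℕ) :
    ContDiffAt ℝ n (fun y₁ : ℝ => dyadicBump (y₁ / 2 ^ i.1) * (dyadicBump (y₂ / 2 ^ i.2) *
        ((((d₁ : ℝ) * d₂ * y₂) ^ (-(1 : ℝ) / 2) * (r : ℝ)⁻¹) * y₁ ^ (-(1 : ℝ) / 2) *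
          (cutoffW (((d₁ : ℝ) * d₂ * y₂ / qhat q ^ 2) * y₁) *
            besselJ 1 ((4 * π * Real.sqrt ((α : ℝ) * β * y₂) / ((q : ℝ) * r)) * Real.sqrt y₁))))) y₁ := by
  have ha : 0 < (d₁ : ℝ) * d₂ * y₂ / qhat q ^ 2 := by
    have h1 : (0 : ℝ) < d₁ := by exact_mod_cast hd₁
    have h2 : (0 : ℝ) < d₂ := by exact_mod_cast hd₂
    have hQ : 0 < qhat q := qhat_pos_of_neZero q
    positivity
  exact (((contDiff_dyadicBump_nat n).comp (contDiff_id.div_const _)).contDiffAt).mul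
    (contDiffAt_const.mul (contDiffAt_profile _ ha 1 _ hy₁ n))

/-- **All `y₁`-derivatives of the box weight.** For `q, d₁, d₂ ≥ 1`, a box `i`, `y₂ > 0` and `0 < y₁ ≤ 2·2^{i₁}`:
`‖∂₁ᵏ Φ_i(y₁,y₂)‖ ≤ 𝓒_k (1 + b√y₁)ᵏ · (θ(y₂/2^{i₂}) · ((d₁d₂y₂)^{−1/2} r⁻¹ · y₁^{−1/2})) · y₁^{−k}`,
`b = 4π√(αβy₂)/(qr)`, `𝓒_k = Σ_{j≤k} binom(k,j) 2ʲΘⱼ ((k−j)+1)²(k−j)!(k−j)^{k−j}`. [folklore] -/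
theorem norm_iteratedDeriv_boxWeight_slice_le [NeZero q] (hd₁ : 1 ≤ d₁) (hd₂ : 1 ≤ d₂) (i : ℕ × ℕ) (k : ℕ)
    {y₂ : ℝ} (hy₂ : 0 < y₂) {y₁ : ℝ} (hy₁ : 0 < y₁) (hy₁K : y₁ ≤ 2 * 2 ^ i.1) :
    ‖iteratedDeriv k (fun s : ℝ => boxWeight q d₁ d₂ α β r i s y₂) y₁‖ ≤
      (∑ j ∈ Finset.range (k + 1), (k.choose j : ℝ) * (2 ^ j * dyadicBumpBound j) *
          ((((k - j : ℕ) : ℝ) + 1) ^ 2 * (k - j) ! * ((k - j : ℕ) : ℝ) ^ (k - j))) *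
        (1 + |4 * π * Real.sqrt ((α : ℝ) * β * y₂) / ((q : ℝ) * r)| * Real.sqrt y₁) ^ k *
        (|dyadicBump (y₂ / 2 ^ i.2)| *
          (|((d₁ : ℝ) * d₂ * y₂) ^ (-(1 : ℝ) / 2) * (r : ℝ)⁻¹| * y₁ ^ (-(1 : ℝ) / 2))) *
        (y₁ ^ k)⁻¹ := by
  have ha : 0 < (d₁ : ℝ) * d₂ * y₂ / qhat q ^ 2 := by
    have h1 : (0 : ℝ) < d₁ := by exact_mod_cast hd₁
    have h2 : (0 : ℝ) < d₂ := by exact_mod_cast hd₂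
    have hQ : 0 < qhat q := qhat_pos_of_neZero q
    positivity
  rw [boxWeight_slice_eq i hy₂.le]
  -- the `ofReal` isometry does not change the norm of the derivatives
  have hreal := contDiffAt_boxSlice (q := q) (α := α) (β := β) (r := r) hd₁ hd₂ i hy₂ hy₁ k
  have hiso := Complex.ofRealLI.norm_iteratedFDeriv_comp_left (i := k) hreal le_rfl
  rw [← norm_iteratedFDeriv_eq_norm_iteratedDeriv, show (fun y₁ : ℝ => (((dyadicBump (y₁ / 2 ^ i.1) *
      (dyadicBump (y₂ / 2 ^ i.2) * ((((d₁ : ℝ) * d₂ * y₂) ^ (-(1 : ℝ) / 2) * (r : ℝ)⁻¹) * y₁ ^ (-(1 : ℝ) / 2) *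
        (cutoffW (((d₁ : ℝ) * d₂ * y₂ / qhat q ^ 2) * y₁) *
          besselJ 1 ((4 * π * Real.sqrt ((α : ℝ) * β * y₂) / ((q : ℝ) * r)) * Real.sqrt y₁)))) : ℝ)) : ℂ)) =
      Complex.ofRealLI ∘ fun y₁ : ℝ => dyadicBump (y₁ / 2 ^ i.1) *
        (dyadicBump (y₂ / 2 ^ i.2) * ((((d₁ : ℝ) * d₂ * y₂) ^ (-(1 : ℝ) / 2) * (r : ℝ)⁻¹) * y₁ ^ (-(1 : ℝ) / 2) *
          (cutoffW (((d₁ : ℝ) * d₂ * y₂ / qhat q ^ 2) * y₁) *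
            besselJ 1 ((4 * π * Real.sqrt ((α : ℝ) * β * y₂) / ((q : ℝ) * r)) * Real.sqrt y₁)))) from rfl,
    hiso, norm_iteratedFDeriv_eq_norm_iteratedDeriv, Real.norm_eq_abs]
  -- the weighted slice bound of step 5, divided by `y₁^k`
  have hslice := abs_pow_mul_iteratedDeriv_boxSlice_le (K := (2 : ℝ) ^ i.1) (by positivity)
    (dyadicBump (y₂ / 2 ^ i.2)) (((d₁ : ℝ) * d₂ * y₂) ^ (-(1 : ℝ) / 2) * (r : ℝ)⁻¹) ha 1
    (4 * π * Real.sqrt ((α : ℝ) * β * y₂) / ((q : ℝ) * r)) k hy₁ hy₁K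
  rw [abs_mul, abs_of_pos (pow_pos hy₁ k)] at hslice
  rw [← le_div_iff₀' (pow_pos hy₁ k), div_eq_mul_inv] at hslice
  exact hslice

end BoxWeight

end Summit.Parity.GeneralizedHardyLittlewood.Theorems.BeyondDiagonalBeatsQuarter.OffDiagPoissonTwisted
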